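import Literature.AlgebraicGeometry.GroupSchemes.BTGroupConnectedDimOneCoordinates      -- ★ p845010: `finrank_eq_of_algEquiv_quotient_X_pow`, `BTGroup.isAffine_left` (brings `Alg`, `BTGroup`)
import Literature.AlgebraicGeometry.GroupSchemes.UnitComponentReductionKernel            -- ★ `UnitComponent.isLocalRing_of_connectedSpace`
import Literature.AlgebraicGeometry.Morphisms.CotangentRankOfDualNumberLifts             -- ★ `finrank_residueField_cotangentSpace_eq_finrank_ker_cotangent` (brings `TangentHom`)
import Literature.AlgebraicGeometry.Morphisms.FiniteFlatRankComp                         -- ★ `finrank_eq_finrank_appTop`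
import Literature.RingTheory.PrincipalIdealRing.MonogenicLocalAlgebraTruncatedPolynomial   -- ★ A–M 8.8: `exists_nonempty_algEquiv_polynomial_quotient_X_pow_of_finrank_cotangentSpace_le_one`
import HarnessLib

/-!
# Connected + tangent rank `≤ 1` ⇒ the layers are `k[X]⧸(X^{p^{nH}})`: the PRODUCER of `IsConnectedDimOne`
# ([Tate 1967] §2.2; [Messing 1972] II (3.3.18); [Atiyah–Macdonald] Prop. 8.8)

Topic `Literature/AlgebraicGeometry/GroupSchemes`; namespace `Literature.AlgebraicGeometry.GroupSchemes`.  THEOREMS ONLY (no definition, no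
named fact, no instance, no notation, no `sorry`).  Cell `hodgecm-mathlib`, P6 «MOD programme», sub-desk F0P6d ∕ HEART: the hypothesis
`IsConnectedDimOne B` («`Γ(B.G n) ≃ₐ[k] k[X]⧸(X^{p^{nH}})` for every layer», ★ `BTGroupNilpotentPoints`) of the dictionary letter (HL-D) and the
monogenic hypothesis `Γ(G₀) ≃ₐ k[X]⧸(X^{p^n})` of the DICT organ (μ4) are here DERIVED from geometric input available at a special point:
the layer (resp. the finite `k`-group scheme) is CONNECTED, carries a `k`-point (the unit), and its Zariski tangent space there has
dimension `≤ 1` — stated in the locality-free currency `dim_k (ker ε)⧸(ker ε)² ≤ 1` of an augmentation `ε : Γ → k` (★ `DualNumberPoints.TangentHom`,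
★ `CotangentRankOfDualNumberLifts`).  No algebraic closedness of `k` is needed (the `k`-point `ε` makes the residue field `k`).  HC_CM is proved
only modulo the printed citations until rung 0 closes; nothing here is about HC.

THE PRINT.  [Tate1967] §2.2 (proof of Prop. 1): the affine algebra of a layer of a CONNECTED `p`-divisible group over a field is a local Artin
algebra `k[X₁,…,X_d]⧸(…)` with `d` = the dimension; [Messing1972] II (3.3.18).  [AtiyahMacdonald1969] Ch. 8 Prop. 8.8 and the Example after it:
an Artin local ring with `dim_k 𝔪⧸𝔪² ≤ 1` (and residue field `k`) is `k[X]⧸(Xⁿ)` — ★ `MonogenicLocalAlgebraTruncatedPolynomial`.  [GortzWedhorn2020]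
(6.4): the Zariski tangent space at a `k`-point as `(𝔪⧸𝔪²)^∨`; (12.6): the rank of a finite flat morphism.

MAIN STATEMENTS.  §1 `finrank_alg_eq_finrank_hom` (`dim_k Γ(X) = X.hom.finrank pt` for `X → Spec k` finite flat), `isLocalRing_alg_of_connectedSpace`,
`exists_sub_algebraMap_mem_maximalIdeal_of_augmentation` (residue field `k` from a `k`-point); §2 **`exists_algEquiv_quotient_X_pow_of_connectedSpace`**
(single finite connected `X → Spec k` with a `k`-point of tangent rank `≤ 1`: `Γ(X) ≃ₐ[k] k[X]⧸(X^{rank})`); §3 **`BTGroup.isConnectedDimOne_of_finrank_cotangent_le_one`**.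

## References
* [Tate1967] J. T. Tate, *p-divisible groups*, Proc. Conf. Local Fields (Driebergen, 1966), Springer (1967) — §2.2, proof of Prop. 1.
* [Messing1972] W. Messing, *The Crystals Associated to Barsotti–Tate Groups*, LNM 264 (1972) — Ch. II, (3.3.18).
* [AtiyahMacdonald1969] M. F. Atiyah, I. G. Macdonald, *Introduction to Commutative Algebra* (1969) — Ch. 8, Prop. 8.8 and Example.
* [GortzWedhorn2020] U. Görtz, T. Wedhorn, *Algebraic Geometry I* (2nd ed. 2020) — (6.4) Def. 6.2 ∕ Prop. 6.7; (12.6).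
-/

set_option autoImplicit false

-- Mathlib's `Over`/`Scheme` APIs are stated across semireducible wrappers (as in the ★ `GroupSchemes/*` files).
set_option backward.isDefEq.respectTransparency false

noncomputable section

universe u

open AlgebraicGeometry CategoryTheory Polynomial IsLocalRing
open Literature.AlgebraicGeometry.Motives (algebraMapΓ)

namespace Literature.AlgebraicGeometry.GroupSchemes

variable {k : Type u} [Field k]

/-! ## §1 A finite `k`-scheme: dimension = rank; connected ⇒ local; a `k`-point ⇒ residue field `k` -/

/-- **`dim_k Γ(X, 𝒪_X) = rank of X → Spec k`** for a finite flat `X` over a field (Mathlib's pointwise `Scheme.Hom.finrank`; ★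
`finrank_eq_finrank_appTop`, transport `Γ(Spec k) ≅ k` by Mathlib `RingHom.finrank_comp_right_of_bijective`, and `rankAtStalk = finrank` over a
field). [cite: GortzWedhorn2020, Section (12.6)] -/
theorem finrank_alg_eq_finrank_hom (X : Over (Spec (.of k))) [IsFinite X.hom] [Flat X.hom] (pt : Spec (.of k)) :
    Module.finrank k (AffineGroupScheme.Alg X) = X.hom.finrank pt := by
  haveI : IsAffine X.left := isAffine_of_isAffineHom X.hom
  rw [Literature.AlgebraicGeometry.Morphisms.finrank_eq_finrank_appTop X.hom pt]
  let ι₀ : k →+* Γ(Spec (.of k), ⊤) := (Scheme.ΓSpecIso (.of k)).inv.hom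
  have hι₀ : Function.Bijective ι₀ := ConcreteCategory.bijective_of_isIso (Scheme.ΓSpecIso (.of k)).inv
  have h1 := RingHom.finrank_comp_right_of_bijective ι₀ X.hom.appTop.hom hι₀ X.hom.finite_appTop X.hom.flat_appTop
      (PrimeSpectrum.comap ι₀ ((Spec (CommRingCat.of k)).isoSpec.hom pt)) ((Spec (CommRingCat.of k)).isoSpec.hom pt) rfl
  rw [← h1]
  -- `X.hom.appTop ∘ ι₀` IS the `k`-algebra structure map of `Alg X` (`algebraMapΓ`), so `RingHom.finrank` is `rankAtStalk` of `Alg X`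
  haveI : Module.Finite k (AffineGroupScheme.Alg X) := AffineGroupScheme.Alg.moduleFinite X
  exact (congr_fun (Module.rankAtStalk_eq_finrank_of_free (R := k) (M := AffineGroupScheme.Alg X)) _).symm

/-- **A finite CONNECTED `k`-scheme has local affine algebra** (a module-finite algebra over a field with connected spectrum is local, ★
`UnitComponent.isLocalRing_of_connectedSpace` with Mathlib `Field.henselian`; `Spec Γ(X) ≅ X`). [cite: Tate1967, §2.2 (proof of Prop. 1)] -/
theorem isLocalRing_alg_of_connectedSpace (X : Over (Spec (.of k))) [IsFinite X.hom] (hc : ConnectedSpace X.left) :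
    IsLocalRing (AffineGroupScheme.Alg X) := by
  haveI : IsAffine X.left := isAffine_of_isAffineHom X.hom
  haveI : Module.Finite k (AffineGroupScheme.Alg X) := AffineGroupScheme.Alg.moduleFinite X
  haveI : ConnectedSpace (PrimeSpectrum (AffineGroupScheme.Alg X)) :=
    Function.Surjective.connectedSpace (f := X.left.isoSpec.hom.base)
      (ConcreteCategory.bijective_of_isIso X.left.isoSpec.hom.base).2 X.left.isoSpec.hom.base.hom.continuous
  exact UnitComponent.isLocalRing_of_connectedSpace k

/-- **A `k`-point makes the residue field `k`** (elementwise): for a local `k`-algebra `A` with an augmentation `ε : A → k`, every `a` is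
congruent to the scalar `ε a` modulo `𝔪 = ker ε`. [cite: GortzWedhorn2020, (6.4) Def. 6.2] -/
theorem exists_sub_algebraMap_mem_maximalIdeal_of_augmentation {A : Type u} [CommRing A] [Algebra k A] [IsLocalRing A]
    (ε : A →ₐ[k] k) (a : A) : ∃ c : k, a - algebraMap k A c ∈ maximalIdeal A := by
  refine ⟨ε a, ?_⟩
  rw [← Literature.RingTheory.CompleteLocalRings.TangentHom.ker_eq_maximalIdeal ε, RingHom.mem_ker, map_sub, AlgHom.commutes, Algebra.algebraMap_self, RingHom.id_apply, sub_self]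

/-! ## §2 One connected layer with a `k`-point of tangent rank `≤ 1` is `Spec k[X]⧸(X^{rank})` -/

/-- **MONOGENIC LAYER.**  Let `X → Spec k` be finite (flat) with `X` CONNECTED, `ε : Γ(X) → k` a `k`-point, and suppose the Zariski
tangent space at `ε` has dimension `≤ 1` (`dim_k (ker ε)⧸(ker ε)² ≤ 1`).  Then `Γ(X, 𝒪_X) ≃ₐ[k] k[X]⧸(X^N)` with `N` the RANK of `X → Spec k`.
(Local by connectedness, Artin by finiteness, residue field `k` by the point, principal `𝔪` by the tangent bound — A–M 8.8 — and the
exponent is the `k`-dimension.) [cite: AtiyahMacdonald1969, Ch. 8, Prop. 8.8 and Example] [cite: Tate1967, §2.2 (proof of Prop. 1)] -/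
theorem exists_algEquiv_quotient_X_pow_of_connectedSpace (Z : Over (Spec (.of k))) [IsFinite Z.hom] [Flat Z.hom]
    (hc : ConnectedSpace Z.left) (ε : AffineGroupScheme.Alg Z →ₐ[k] k)
    (htan : Module.finrank k (RingHom.ker ε.toRingHom).Cotangent ≤ 1) (pt : Spec (.of k)) :
    Nonempty (AffineGroupScheme.Alg Z ≃ₐ[k] (k[X] ⧸ Ideal.span {(X : k[X]) ^ Z.hom.finrank pt})) := by
  haveI : IsLocalRing (AffineGroupScheme.Alg Z) := isLocalRing_alg_of_connectedSpace Z hc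
  haveI : Module.Finite k (AffineGroupScheme.Alg Z) := AffineGroupScheme.Alg.moduleFinite Z
  haveI : IsArtinianRing (AffineGroupScheme.Alg Z) := IsArtinianRing.of_finite k _
  have hcot : Module.finrank (ResidueField (AffineGroupScheme.Alg Z)) (CotangentSpace (AffineGroupScheme.Alg Z)) ≤ 1 := by
    rw [Literature.AlgebraicGeometry.Morphisms.finrank_residueField_cotangentSpace_eq_finrank_ker_cotangent ε]
    exact htan
  obtain ⟨m, ⟨ψ⟩⟩ :=
    Literature.RingTheory.PrincipalIdealRing.exists_nonempty_algEquiv_polynomial_quotient_X_pow_of_finrank_cotangentSpace_le_one hcot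
      (exists_sub_algebraMap_mem_maximalIdeal_of_augmentation ε)
  have hm : m = Z.hom.finrank pt := by rw [← finrank_alg_eq_finrank_hom Z pt, finrank_eq_of_algEquiv_quotient_X_pow ψ]
  have hI : Ideal.span {(X : k[X]) ^ m} = Ideal.span {(X : k[X]) ^ Z.hom.finrank pt} := by rw [hm]
  exact ⟨ψ.trans (Ideal.quotientEquivAlgOfEq k hI)⟩

/-! ## §3 `IsConnectedDimOne` for a BT group over a field from connectedness and tangent rank -/

/-- **CONNECTED + TANGENT RANK `≤ 1` ⇒ `IsConnectedDimOne`.**  A Barsotti–Tate group `B` of height `H` over a field `k` whose layers are CONNECTED and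
carry a `k`-point of tangent rank `≤ 1` (for the unit section: `dim_k 𝔪_e⧸𝔪_e² ≤ 1` — «`B` is one-dimensional») has
`Γ(B.G n) ≃ₐ[k] k[X]⧸(X^{p^{nH}})` for every `n` — the hypothesis `IsConnectedDimOne B` of the dictionary letter (HL-D) ∕ ★
`BTGroupConnectedDimOneCoordinates`, with the exponent read off `B.finrank_eq`. [cite: Tate1967, §2.2 (proof of Prop. 1)] [cite: Messing1972, Ch. II (3.3.18)] -/
theorem BTGroup.isConnectedDimOne_of_finrank_cotangent_le_one {p H : ℕ} (B : BTGroup (Spec (.of k)) p H)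
    (hconn : ∀ n, ConnectedSpace (B.G n).left)
    (htan : ∀ n, ∃ ε : AffineGroupScheme.Alg (B.G n) →ₐ[k] k, Module.finrank k (RingHom.ker ε.toRingHom).Cotangent ≤ 1) :
    IsConnectedDimOne B := by
  intro n
  haveI := B.isFinite n
  haveI := B.flat n
  obtain ⟨ε, hε⟩ := htan n
  let pt : Spec (.of k) := (⊥ : PrimeSpectrum k)
  obtain ⟨ψ⟩ := exists_algEquiv_quotient_X_pow_of_connectedSpace (B.G n) (hconn n) ε hε pt
  have hI : Ideal.span {(X : k[X]) ^ (B.G n).hom.finrank pt} = Ideal.span {(X : k[X]) ^ (p ^ (n * H))} := by rw [B.finrank_eq n pt]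
  exact ⟨ψ.trans (Ideal.quotientEquivAlgOfEq k hI)⟩

end Literature.AlgebraicGeometry.GroupSchemes

end
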